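import Summits.RiemannHypothesis.RiemannHypothesis.Theorems.SoloInformedAnticlusteringRH
import Summits.RiemannHypothesis.RiemannHypothesis.Theorems.SoloInformedAnticlusteringLaw
import Literature.NumberTheory.LFunctions.WeilLineSupSampling
import Literature.NumberTheory.LFunctions.WeilChirpDecay
import HarnessLib

/-!
# RH ⟹ the double-exponential lower law for Weil's functional (E3, soloist)

Sorry-free.  The end of the chain T65–T72 of the soloist's `paper/sharpest.md` §2k:

**Theorem** (`weilQuadratic_re_ge_exp_neg_exp_of_riemannHypothesis`).  Assume RH.  There is
`A > 0` such that for every `a ≥ 1` and every Weil test `g` with `supp g ⊆ [−a, a]` and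
`‖g‖₂ = 1`, `Re W(g ⋆ g̃) ≥ exp(−exp(A a))`.

Equivalently, under RH the Weil ground energy `ε(a) = inf Re W(g ⋆ g̃)` over unit tests on
`[−a, a]` satisfies `log log (1/ε(a)) ≤ A a`; the unconditional upper law (T2,
`SoloInformedUpperLaw`) gives `log log (1/ε(a)) ≥ 2a − O(1)`, so `log log (1/ε(a)) ≍ a` under RH.
Previously (T68) the lower law was conditional on the anticlustering hypothesis (AC*); T72i
(`anticlustering_of_riemannHypothesis`) derives (AC*) from RH via the pair-correlation
rigidity lemma 2k.E, and this file supplies the probe `Φ` (a dilated bump: `supp Φ ⊆ [−1, 1]`,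
`|Φ̂(1/2 + iu)|² ≥ μ > 0` on `|u| ≤ 2`, from continuity of `φ̂` at `1/2` and `φ̂(1/2) ≠ 0`).
-/

noncomputable section

open Real Complex MeasureTheory Set Filter Literature.NumberTheory.LFunctions

namespace Summit.RiemannHypothesis.RiemannHypothesis.Theorems

/-- A Weil test `Φ` on `[−1, 1]` whose Mellin transform is bounded below on
`{1/2 + iu : |u| ≤ 2}`: a dilate of a nonnegative bump. -/
theorem exists_isWeilTest_mellin_floor :
    ∃ Φ : ℝ → ℂ, ∃ μ : ℝ, IsWeilTest Φ ∧ tsupport Φ ⊆ Icc (-1) 1 ∧ 0 < μ ∧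
      ∀ u : ℝ, |u| ≤ 2 → μ ≤ ‖weilMellin Φ (1 / 2 + u * I)‖ ^ 2 := by
  obtain ⟨φ, hφ, hsupp, hne⟩ := exists_isWeilTest_bump_weilMellin_half_ne_zero one_pos
  have hc := continuous_weilMellin_line hφ
  have hpos : 0 < ‖weilMellin φ (1 / 2)‖ := norm_pos_iff.2 hne
  obtain ⟨δ, hδ, hδ'⟩ := Metric.continuous_iff.1 hc 0 (‖weilMellin φ (1 / 2)‖ / 2)
    (half_pos hpos)
  obtain ⟨m, hm⟩ : ∃ m : ℝ, m = min δ 2 := ⟨_, rfl⟩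
  have hm0 : 0 < m := by rw [hm]; exact lt_min hδ two_pos
  have hm2 : m ≤ 2 := hm ▸ min_le_right _ _
  have hmδ : m ≤ δ := hm ▸ min_le_left _ _
  obtain ⟨η, hη⟩ : ∃ η : ℝ, η = 4 / m - 1 := ⟨_, rfl⟩
  have h1η : 1 + η = 4 / m := by rw [hη]; ring
  have h2 : (2 : ℝ) ≤ 1 + η := by rw [h1η, le_div_iff₀ hm0]; linarith
  have hη1 : -1 < η := by linarith
  have hpos' : (0 : ℝ) < 1 + η := by linarith
  refine ⟨weilDilate η φ, (‖weilMellin φ (1 / 2)‖ / 2) ^ 2 / (1 + η), hφ.weilDilate hη1, ?_,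
    div_pos (pow_pos (half_pos hpos) 2) hpos', fun u hu ↦ ?_⟩
  · refine (tsupport_weilDilate_subset φ hη1 hsupp).trans (Icc_subset_Icc ?_ ?_)
    · rw [neg_le_neg_iff, div_le_one hpos']; linarith
    · rw [div_le_one hpos']; linarith
  -- the Mellin transform of the dilate at `1/2 + iu` is `(1+η)^{-1/2} φ̂(1/2 + iu/(1+η))`
  have harg : (1 : ℂ) / 2 + ((1 : ℂ) / 2 + (u : ℂ) * I - 1 / 2) / ((1 + η : ℝ) : ℂ) =
      1 / 2 + ((u / (1 + η) : ℝ) : ℂ) * I := by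
    rw [add_sub_cancel_left, Complex.ofReal_div, div_mul_eq_mul_div]
  have hM : weilMellin (weilDilate η φ) (1 / 2 + u * I) =
      (Real.sqrt (1 + η) : ℂ) * ((1 + η : ℝ) : ℂ)⁻¹ *
        weilMellin φ (1 / 2 + ((u / (1 + η) : ℝ) : ℂ) * I) := by
    rw [weilMellin_weilDilate φ hη1, harg]
  have hnorm : ‖weilMellin (weilDilate η φ) (1 / 2 + u * I)‖ ^ 2 =
      ‖weilMellin φ (1 / 2 + ((u / (1 + η) : ℝ) : ℂ) * I)‖ ^ 2 / (1 + η) := by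
    rw [hM, norm_mul, norm_mul, Complex.norm_real, Real.norm_of_nonneg (Real.sqrt_nonneg _),
      norm_inv, Complex.norm_real, Real.norm_of_nonneg hpos'.le, mul_pow, mul_pow,
      Real.sq_sqrt hpos'.le, inv_pow]
    field_simp
  -- `|u/(1+η)| < δ`, so `‖φ̂(1/2 + iu/(1+η))‖ ≥ ‖φ̂(1/2)‖ / 2`
  have hsmall : dist (u / (1 + η)) 0 < δ := by
    rw [dist_zero_right, Real.norm_eq_abs, abs_div, abs_of_pos hpos', h1η,
      div_div_eq_mul_div]
    rw [div_lt_iff₀ (by norm_num : (0 : ℝ) < 4)]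
    nlinarith [abs_nonneg u]
  have hd := hδ' (u / (1 + η)) hsmall
  rw [dist_eq_norm, show (1 : ℂ) / 2 + ((0 : ℝ) : ℂ) * I = 1 / 2 by simp] at hd
  have hlow : ‖weilMellin φ (1 / 2)‖ / 2 ≤
      ‖weilMellin φ (1 / 2 + ((u / (1 + η) : ℝ) : ℂ) * I)‖ := by
    have := norm_sub_norm_le (weilMellin φ (1 / 2))
      (weilMellin φ (1 / 2 + ((u / (1 + η) : ℝ) : ℂ) * I))
    rw [norm_sub_rev] at hd
    linarith
  rw [hnorm]
  exact div_le_div_of_nonneg_right (pow_le_pow_left₀ (by positivity) hlow 2) hpos'.le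

/-- **RH ⟹ the double-exponential lower law** for Weil's quadratic functional on unit tests
supported in `[−a, a]`.  See the module docstring. -/
theorem weilQuadratic_re_ge_exp_neg_exp_of_riemannHypothesis (hRH : _root_.RiemannHypothesis) :
    ∃ A : ℝ, 0 < A ∧ ∀ a : ℝ, 1 ≤ a → ∀ g : ℝ → ℂ, IsWeilTest g → tsupport g ⊆ Icc (-a) a →
      ∫ t, ‖g t‖ ^ 2 = (1 : ℝ) → Real.exp (-Real.exp (A * a)) ≤ (weilQuadratic g).re := by
  obtain ⟨Φ, μ, hΦ, ha, hμ0, hμ⟩ := exists_isWeilTest_mellin_floor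
  obtain ⟨c, tstar, hc, hAC⟩ := anticlustering_of_riemannHypothesis hRH hΦ ha hμ0 hμ
  exact weilQuadratic_re_ge_exp_neg_exp_of_anticlustering hRH hc le_rfl (n := 1)
    (tstar := tstar) fun t V h1 h2 h3 ↦ hAC t V h1 (by simpa using h2) h3

end Summit.RiemannHypothesis.RiemannHypothesis.Theorems

end
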